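import Mathlib

/-!
# Galois-invariant fractional ideals over a PID base (stub `stub_invariantIdeal`)

For a Galois number field `N`, a subfield `F` whose ring of integers is a PID, and a nonzero
fractional ideal `I` of `N` stable under `Gal(N/F)`, there is `c ∈ Fˣ` such that `I` and `(c)`
have the same multiplicity at every prime of `N` that is unramified over `F`.

Proof: the primes of `N` above a prime `𝔩` of `F` form one `Gal(N/F)`-orbit, and the
multiplicity `w ↦ v_w(I)` is `Gal(N/F)`-invariant for an invariant `I`, hence constant (`= n_𝔩`)
along the primes above `𝔩`; writing `𝔩 = (π_𝔩)` we have `v_w(π_𝔩 𝓞_N) = e(w | 𝔩) [w ∣ 𝔩]`, so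
`c = ∏_𝔩 π_𝔩 ^ n_𝔩` (over the finitely many `𝔩` below the support of `I`) works at every `w`
with `e(w | 𝔩_w) = 1`.
-/

set_option linter.dupNamespace false

noncomputable section

namespace Summit.QuantumAdvantage.QuantumAdvantage.Theorems.LinnikCubicClassGroups

open NumberField IsDedekindDomain FractionalIdeal
open scoped nonZeroDivisors Pointwise

/-! ### Multiplicities in a Dedekind domain under a ring automorphism -/

section Dedekind

variable {R : Type*} [CommRing R] [IsDedekindDomain R] (K : Type*) [Field K] [Algebra R K]
  [IsFractionRing R K]

/-- The multiplicity `count K v J` of a nonzero integral ideal `J` at `v` is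
`multiplicity v J`. [folklore] -/
theorem count_coe_eq_multiplicity (v : HeightOneSpectrum R) {J : Ideal R} (hJ : J ≠ ⊥) :
    count K v (J : FractionalIdeal R⁰ K) = multiplicity v.asIdeal J := by
  classical
  rw [count_coe K v (by simpa using hJ), Ideal.count_associates_factors_eq hJ v.isPrime v.ne_bot,
    HeightOneSpectrum.count_normalizedFactors_eq_multiplicity hJ v]

/-- If a ring automorphism `g` of the Dedekind domain `R` fixes the integral ideal `J`, then
`J` has the same multiplicity at `v` and at `g • v`. [folklore] -/
theorem count_coe_eq_of_smul_eq {G : Type*} [Group G] [MulSemiringAction G R] (g : G)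
    (v w : HeightOneSpectrum R) (hw : w.asIdeal = g • v.asIdeal) {J : Ideal R}
    (hJ : g • J = J) :
    count K w (J : FractionalIdeal R⁰ K) = count K v (J : FractionalIdeal R⁰ K) := by
  by_cases hJ0 : J = ⊥
  · simp [hJ0, count_zero]
  rw [count_coe_eq_multiplicity K v hJ0, count_coe_eq_multiplicity K w hJ0, hw]
  conv_lhs => rw [← hJ]
  exact_mod_cast multiplicity_map_eq (MulSemiringAction.toRingEquiv G (Ideal R) g)

/-- `spanSingleton` commutes with integer powers. [folklore] -/
theorem spanSingleton_zpow (x : K) (n : ℤ) :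
    spanSingleton R⁰ x ^ n = spanSingleton R⁰ (x ^ n) := by
  obtain ⟨n, rfl | rfl⟩ := n.eq_nat_or_neg
  · rw [zpow_natCast, zpow_natCast, spanSingleton_pow]
  · rw [zpow_neg, zpow_neg, zpow_natCast, zpow_natCast, spanSingleton_pow, spanSingleton_inv]

omit [IsDedekindDomain R] in
/-- `spanSingleton` commutes with finite products. [folklore] -/
theorem spanSingleton_prod {ι : Type*} (s : Finset ι) (f : ι → K) :
    spanSingleton R⁰ (∏ i ∈ s, f i) = ∏ i ∈ s, spanSingleton R⁰ (f i) := by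
  classical
  induction s using Finset.induction with
  | empty => rw [Finset.prod_empty, Finset.prod_empty, spanSingleton_one]
  | insert i s hi ih => rw [Finset.prod_insert hi, Finset.prod_insert hi, ← ih,
      spanSingleton_mul_spanSingleton]

end Dedekind

/-! ### Fractional ideals of a number field stable under a group of automorphisms -/

section NumberField

variable (N : Type) [Field N] [NumberField N]

/-- A fractional ideal of a number field has an integral model with a natural-number
denominator: `I = m⁻¹ J` with `m ∈ ℕ`, `m ≠ 0`, `J ⊆ 𝓞 N`. [folklore] -/
theorem exists_eq_spanSingleton_natCast_inv_mul (I : FractionalIdeal (𝓞 N)⁰ N) :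
    ∃ (m : ℕ) (J : Ideal (𝓞 N)), m ≠ 0 ∧
      I = spanSingleton (𝓞 N)⁰ ((m : N))⁻¹ * (J : FractionalIdeal (𝓞 N)⁰ N) := by
  obtain ⟨a, aI, ha, haI⟩ := exists_eq_spanSingleton_mul I
  set m : ℕ := Ideal.absNorm (Ideal.span {a}) with hm
  have hm0 : m ≠ 0 := by
    rw [hm, Ne, Ideal.absNorm_eq_zero_iff, Ideal.span_singleton_eq_bot]
    exact ha
  obtain ⟨t, ht⟩ := Ideal.mem_span_singleton'.mp (Ideal.absNorm_mem (Ideal.span {a}))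
  refine ⟨m, Ideal.span {t} * aI, hm0, ?_⟩
  have hmN : ((m : N)) = algebraMap (𝓞 N) N t * algebraMap (𝓞 N) N a := by
    rw [← map_mul, ht, map_natCast]
  have ht' : (algebraMap (𝓞 N) N t) ≠ 0 := by
    intro h0
    rw [h0, zero_mul, Nat.cast_eq_zero] at hmN
    exact hm0 hmN
  rw [haI, coeIdeal_mul, coeIdeal_span_singleton, ← mul_assoc, spanSingleton_mul_spanSingleton,
    hmN, mul_inv_rev, mul_assoc, inv_mul_cancel₀ ht', mul_one]

/-- The action of `g ∈ Aut(N)` on `𝓞 N`, seen in `N`. [folklore] -/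
theorem algebraMap_smul_ringOfIntegers (g : N ≃ₐ[ℚ] N) (y : 𝓞 N) :
    algebraMap (𝓞 N) N (g • y) = g (algebraMap (𝓞 N) N y) := rfl

/-- If `g(I) ⊆ I` for the automorphism `g` of `N` and `I = m⁻¹ J` with `m ∈ ℕ`, `J ⊆ 𝓞 N`,
then `g • J ≤ J`. [folklore] -/
theorem smul_le_of_apply_mem (g : N ≃ₐ[ℚ] N) {I : FractionalIdeal (𝓞 N)⁰ N}
    (hg : ∀ x ∈ I, g x ∈ I) {m : ℕ} (hm : m ≠ 0) {J : Ideal (𝓞 N)}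
    (hIJ : I = spanSingleton (𝓞 N)⁰ ((m : N))⁻¹ * (J : FractionalIdeal (𝓞 N)⁰ N)) :
    g • J ≤ J := by
  have hmN : (m : N) ≠ 0 := by exact_mod_cast hm
  have hJ : (J : FractionalIdeal (𝓞 N)⁰ N) = spanSingleton (𝓞 N)⁰ (m : N) * I := by
    rw [hIJ, ← mul_assoc, spanSingleton_mul_spanSingleton, mul_inv_cancel₀ hmN,
      spanSingleton_one, one_mul]
  rw [Ideal.pointwise_smul_def, Ideal.map_le_iff_le_comap]
  intro y hy
  rw [Ideal.mem_comap, MulSemiringAction.toRingHom_apply]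
  have hyN : algebraMap (𝓞 N) N y ∈ (J : FractionalIdeal (𝓞 N)⁰ N) :=
    mem_coeIdeal_of_mem (𝓞 N)⁰ hy
  rw [hJ, mem_singleton_mul] at hyN
  obtain ⟨x, hx, hyx⟩ := hyN
  have hgy : algebraMap (𝓞 N) N (g • y) ∈ (J : FractionalIdeal (𝓞 N)⁰ N) := by
    rw [algebraMap_smul_ringOfIntegers, hyx, map_mul, map_natCast, hJ, mem_singleton_mul]
    exact ⟨g x, hg x hx, rfl⟩
  obtain ⟨y', hy', hy'eq⟩ := (mem_coeIdeal (𝓞 N)⁰).mp hgy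
  rwa [← IsFractionRing.injective (𝓞 N) N hy'eq]

/-- If `I` is stable under `g` and `g⁻¹` and `I = m⁻¹ J` (`m ∈ ℕ`, `J ⊆ 𝓞 N`), then
`g • J = J`. [folklore] -/
theorem smul_eq_of_apply_mem (g : N ≃ₐ[ℚ] N) {I : FractionalIdeal (𝓞 N)⁰ N}
    (hg : ∀ x ∈ I, g x ∈ I) (hg' : ∀ x ∈ I, g⁻¹ x ∈ I) {m : ℕ} (hm : m ≠ 0) {J : Ideal (𝓞 N)}
    (hIJ : I = spanSingleton (𝓞 N)⁰ ((m : N))⁻¹ * (J : FractionalIdeal (𝓞 N)⁰ N)) :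
    g • J = J :=
  le_antisymm (smul_le_of_apply_mem N g hg hm hIJ)
    (Ideal.subset_pointwise_smul_iff.mpr (smul_le_of_apply_mem N g⁻¹ hg' hm hIJ))

/-- **Invariance of multiplicities.** If the fractional ideal `I` of `N` is stable under the
automorphism `g` and its inverse, then `I` has the same multiplicity at `v` and at `g • v`.
[folklore] -/
theorem count_eq_of_apply_mem (g : N ≃ₐ[ℚ] N) {I : FractionalIdeal (𝓞 N)⁰ N}
    (hg : ∀ x ∈ I, g x ∈ I) (hg' : ∀ x ∈ I, g⁻¹ x ∈ I) (v w : HeightOneSpectrum (𝓞 N))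
    (hw : w.asIdeal = g • v.asIdeal) : count N w I = count N v I := by
  by_cases hI : I = 0
  · rw [hI, count_zero, count_zero]
  obtain ⟨m, J, hm, hIJ⟩ := exists_eq_spanSingleton_natCast_inv_mul N I
  have hmN : (m : N) ≠ 0 := by exact_mod_cast hm
  have hJ0 : J ≠ ⊥ := by
    rintro rfl
    rw [coeIdeal_bot, mul_zero] at hIJ
    exact hI hIJ
  have hJ : g • J = J := smul_eq_of_apply_mem N g hg hg' hm hIJ
  have hmJ : g • (Ideal.span {(m : 𝓞 N)} : Ideal (𝓞 N)) = Ideal.span {(m : 𝓞 N)} := by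
    rw [Ideal.pointwise_smul_def, Ideal.map_span, Set.image_singleton, map_natCast]
  have key : ∀ u : HeightOneSpectrum (𝓞 N), count N u I =
      count N u (J : FractionalIdeal (𝓞 N)⁰ N) -
        count N u ((Ideal.span {(m : 𝓞 N)} : Ideal (𝓞 N)) : FractionalIdeal (𝓞 N)⁰ N) := by
    intro u
    rw [hIJ, count_mul N u (spanSingleton_ne_zero_iff.mpr (inv_ne_zero hmN))
      (coeIdeal_ne_zero.mpr hJ0), ← spanSingleton_inv, count_inv, coeIdeal_span_singleton,
      map_natCast]
    ring
  rw [key, key, count_coe_eq_of_smul_eq N g v w hw hJ, count_coe_eq_of_smul_eq N g v w hw hmJ]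

variable [IsGalois ℚ N] (F : IntermediateField ℚ N)

/-- **Transitivity.** Two maximal ideals of `𝓞 N` over the same prime of `𝓞 F` are conjugate
under `Gal(N/F) = F.fixingSubgroup`. [folklore] -/
theorem exists_smul_eq_of_under_eq (P Q : Ideal (𝓞 N)) [P.IsMaximal] [Q.IsMaximal]
    (h : P.under (𝓞 F) = Q.under (𝓞 F)) :
    ∃ g : N ≃ₐ[ℚ] N, g ∈ F.fixingSubgroup ∧ g • P = Q := by
  haveI : IsGaloisGroup F.fixingSubgroup F N :=
    IsGaloisGroup.intermediateField (N ≃ₐ[ℚ] N) ℚ N F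
  haveI : IsGaloisGroup F.fixingSubgroup (𝓞 F) (𝓞 N) :=
    IsGaloisGroup.of_isFractionRing F.fixingSubgroup (𝓞 F) (𝓞 N) F N
  haveI : Q.LiesOver (P.under (𝓞 F)) := ⟨h⟩
  obtain ⟨σ, hσ⟩ := Ideal.exists_smul_eq_of_isGaloisGroup (P.under (𝓞 F)) P Q F.fixingSubgroup
  exact ⟨σ.1, σ.2, hσ⟩

/-- **Constancy along fibres.** A `Gal(N/F)`-stable fractional ideal of `N` has the same
multiplicity at any two primes of `N` above the same prime of `F`. [folklore] -/
theorem count_eq_of_under_eq {I : FractionalIdeal (𝓞 N)⁰ N}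
    (hinv : ∀ g : N ≃ₐ[ℚ] N, g ∈ F.fixingSubgroup → ∀ x ∈ I, g x ∈ I)
    (v w : HeightOneSpectrum (𝓞 N)) (h : v.asIdeal.under (𝓞 F) = w.asIdeal.under (𝓞 F)) :
    count N w I = count N v I := by
  haveI := v.isMaximal
  haveI := w.isMaximal
  obtain ⟨g, hg, hgv⟩ := exists_smul_eq_of_under_eq N F v.asIdeal w.asIdeal h
  exact count_eq_of_apply_mem N g (hinv g hg) (hinv g⁻¹ (inv_mem hg)) v w hgv.symm

omit [IsGalois ℚ N] in
/-- **Multiplicity of a principal prime of the base.** For a maximal ideal `𝔩 = (π)` of `𝓞 F`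
and a prime `w` of `𝓞 N`: `v_w(π 𝓞_N) = e(w | 𝔩)` if `w ∣ 𝔩`, and `0` otherwise. [folklore] -/
theorem count_spanSingleton_generator (𝔩 : Ideal (𝓞 F)) [𝔩.IsMaximal] (π : 𝓞 F)
    (hπ : Ideal.span {π} = 𝔩) (w : HeightOneSpectrum (𝓞 N)) :
    count N w (spanSingleton (𝓞 N)⁰ ((π : F) : N)) =
      if w.asIdeal.under (𝓞 F) = 𝔩 then (w.asIdeal.ramificationIdx (𝓞 F) : ℤ) else 0 := by
  have h𝔩 : 𝔩 ≠ ⊥ := Ideal.IsMaximal.ne_bot_of_isIntegral_int 𝔩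
  have hmap : Ideal.map (algebraMap (𝓞 F) (𝓞 N)) 𝔩 ≠ ⊥ := Ideal.map_ne_bot_of_ne_bot h𝔩
  have heq : spanSingleton (𝓞 N)⁰ ((π : F) : N) =
      ((Ideal.map (algebraMap (𝓞 F) (𝓞 N)) 𝔩 : Ideal (𝓞 N)) : FractionalIdeal (𝓞 N)⁰ N) := by
    rw [← hπ, Ideal.map_span, Set.image_singleton, coeIdeal_span_singleton,
      ← IsScalarTower.algebraMap_apply, IsScalarTower.algebraMap_apply (𝓞 F) F N]
    rfl
  rw [heq]
  split_ifs with h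
  · haveI : w.asIdeal.LiesOver 𝔩 := ⟨h.symm⟩
    rw [count_coe_eq_multiplicity N w hmap,
      Ideal.IsDedekindDomain.ramificationIdx_eq_multiplicity 𝔩 w.asIdeal hmap]
  · rw [count_coe_eq_multiplicity N w hmap, Nat.cast_eq_zero, multiplicity_eq_zero]
    intro hdvd
    exact h ((Ideal.liesOver_iff_dvd_map w.isPrime.ne_top).mpr hdvd).over.symm

end NumberField

/-! ### The stub -/

/-- **Galois-invariant fractional ideals over a PID base.**  For a Galois number field `N`, a
subfield `F` whose integers form a PID, and a nonzero fractional ideal `I` of `N` stable under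
`Gal(N/F)`: there is `c ∈ Fˣ` such that `I` and `(c)` have the same multiplicity at every prime
of `N` unramified over `F` (the primes above a prime `𝔩 = (π)` of `F` form one `Gal(N/F)`-orbit,
so `I` has a constant multiplicity `n_𝔩` along it, and `v_w(π 𝓞_N) = e(w ∣ 𝔩) = 1` for `w ∣ 𝔩`
unramified; take `c = ∏ π^{n_𝔩}`). [folklore] -/
theorem stub_invariantIdeal (N : Type) [Field N] [NumberField N] [IsGalois ℚ N]
    (F : IntermediateField ℚ N) (hPID : IsPrincipalIdealRing (𝓞 F))
    (I : FractionalIdeal (𝓞 N)⁰ N) (hI : I ≠ 0)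
    (hinv : ∀ g : N ≃ₐ[ℚ] N, g ∈ F.fixingSubgroup → ∀ x ∈ I, g x ∈ I) :
    ∃ c : F, c ≠ 0 ∧ ∀ w : HeightOneSpectrum (𝓞 N), w.asIdeal.ramificationIdx (𝓞 F) = 1 →
      FractionalIdeal.count N w I =
        FractionalIdeal.count N w (FractionalIdeal.spanSingleton (𝓞 N)⁰ ((c : N))) := by
  classical
  haveI := hPID
  -- (`hI` belongs to the registered signature; the argument does not need it — for `I = 0` both
  -- sides vanish at every `w`)
  have _hI₀ : I ≠ 0 := hI
  -- the (finite) support `T` of `I`, the primes `S` of `F` below it, generators `π 𝔩` of the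
  -- primes of `F`, and the common multiplicity `n 𝔩` of `I` along the primes above `𝔩`
  set T : Finset (HeightOneSpectrum (𝓞 N)) :=
    (Filter.eventually_cofinite.mp (finite_factors I)).toFinset with hT
  have hTmem : ∀ v : HeightOneSpectrum (𝓞 N), v ∈ T ↔ count N v I ≠ 0 := fun v => by
    rw [hT, Set.Finite.mem_toFinset, Set.mem_setOf_eq]
  set u : HeightOneSpectrum (𝓞 N) → Ideal (𝓞 F) := fun v => v.asIdeal.under (𝓞 F) with hu
  set S : Finset (Ideal (𝓞 F)) := T.image u with hS
  set π : Ideal (𝓞 F) → 𝓞 F := fun 𝔩 => Submodule.IsPrincipal.generator 𝔩 with hπ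
  set n : Ideal (𝓞 F) → ℤ := fun 𝔩 =>
    if h : ∃ v : HeightOneSpectrum (𝓞 N), u v = 𝔩 then count N h.choose I else 0 with hn_def
  have hn : ∀ w : HeightOneSpectrum (𝓞 N), n (u w) = count N w I := by
    intro w
    have h : ∃ v : HeightOneSpectrum (𝓞 N), u v = u w := ⟨w, rfl⟩
    rw [hn_def]
    simp only [dif_pos h]
    exact count_eq_of_under_eq N F hinv w h.choose h.choose_spec.symm
  have hSmax : ∀ 𝔩 ∈ S, 𝔩.IsMaximal := by
    intro 𝔩 h𝔩
    obtain ⟨v, -, rfl⟩ := Finset.mem_image.mp h𝔩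
    haveI := v.isMaximal
    exact Ideal.IsMaximal.under (𝓞 F) v.asIdeal
  have hπne : ∀ 𝔩 ∈ S, ((π 𝔩 : F) : N) ≠ 0 := by
    intro 𝔩 h𝔩 h0
    obtain ⟨v, -, rfl⟩ := Finset.mem_image.mp h𝔩
    have hne : u v ≠ ⊥ := Ideal.under_ne_bot (𝓞 F) v.ne_bot
    apply hne
    rw [Submodule.IsPrincipal.eq_bot_iff_generator_eq_zero, ← RingOfIntegers.coe_eq_zero_iff,
      ← map_eq_zero (algebraMap F N)]
    exact h0
  refine ⟨∏ 𝔩 ∈ S, (π 𝔩 : F) ^ (n 𝔩), ?_, ?_⟩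
  · -- `c ≠ 0`
    refine Finset.prod_ne_zero_iff.mpr fun 𝔩 h𝔩 => zpow_ne_zero _ ?_
    intro h0
    exact hπne 𝔩 h𝔩 (by rw [h0]; rfl)
  · intro w hw
    have hc : (((∏ 𝔩 ∈ S, (π 𝔩 : F) ^ n 𝔩 : F)) : N) = ∏ 𝔩 ∈ S, ((π 𝔩 : F) : N) ^ n 𝔩 := by
      change algebraMap F N _ = _
      rw [map_prod]
      exact Finset.prod_congr rfl fun 𝔩 _ => map_zpow₀ (algebraMap F N) _ _
    have hne : ∀ 𝔩 ∈ S, spanSingleton (𝓞 N)⁰ ((π 𝔩 : F) : N) ^ n 𝔩 ≠ 0 := fun 𝔩 h𝔩 =>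
      zpow_ne_zero _ (spanSingleton_ne_zero_iff.mpr (hπne 𝔩 h𝔩))
    rw [hc, spanSingleton_prod]
    simp_rw [← spanSingleton_zpow]
    rw [count_prod N w S _ hne]
    have hterm : ∀ 𝔩 ∈ S, count N w (spanSingleton (𝓞 N)⁰ ((π 𝔩 : F) : N) ^ n 𝔩) =
        if u w = 𝔩 then n 𝔩 else 0 := by
      intro 𝔩 h𝔩
      haveI := hSmax 𝔩 h𝔩
      rw [count_zpow, count_spanSingleton_generator N F 𝔩 (π 𝔩) (Ideal.span_singleton_generator 𝔩)
        w, hw]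
      simp [hu]
    rw [Finset.sum_congr rfl hterm, Finset.sum_ite_eq]
    split_ifs with hwS
    · exact (hn w).symm
    · by_contra hw0
      exact hwS (Finset.mem_image.mpr ⟨w, (hTmem w).mpr hw0, rfl⟩)

end Summit.QuantumAdvantage.QuantumAdvantage.Theorems.LinnikCubicClassGroups
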